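import Literature.NumberTheory.NumberFields.EisensteinFieldSelmerNormCubeSplitTwo
import HarnessLib

/-!
# `K(S, 3)` of `ℚ(ζ₃)` with THREE split primes: `S = {λ} ∪ {q ∣ N inert} ∪ {ϖᵢ, ϖ̄ᵢ : i ≤ 3}`; the norm-cube classes are
# `[ζ^i (ϖ₁ϖ̄₁²)^{k₁} (ϖ₂ϖ̄₂²)^{k₂} (ϖ₃ϖ̄₃²)^{k₃}]`

Topic `NumberTheory/NumberFields`; namespace `Literature.NumberTheory.NumberFields.K3`. Sequel to `EisensteinFieldSelmerNormCubeSplitTwo`,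
adding a third rational prime `p₃ ≡ 1 (mod 3)` split as `p₃ = ϖ₃ϖ̄₃`, `ϖ₃ = a₃' + b₃'ζ` (pairwise distinct `p₁, p₂, p₃`). For the `3`-isogeny
descent of Cohen–Pazuki ([CohenPazuki2009], Def. 1.3, Thm. 2.1) this is the Selmer box of the `μ₃`-kernel side when `2b̂√−3` is supported on
`λ`, inert primes and THREE split primes — the shape of the rank-3 curves 287014d1 and 413231b1 (`7·13·19`).
* `associated_of_prime_of_dvd_three_mul_split₃`, **`exists_normal_form_split₃`**, `norm_normalForm_split₃`,
  **`exponents_of_norm_cube_split₃`**, **`exists_cubeClass_eq_of_norm_cube_split₃`** — as in the two-split file with one more pair.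

## References
* [CohenPazuki2009] H. Cohen, F. Pazuki, Acta Arith. 140 (2009), Definition 1.3 (`G₃`), Theorem 2.1.
* [SilvermanAEC2009] J. H. Silverman, *AEC* 2nd ed., Prop. VIII.1.6 (`K(S, n)`).
* [IrelandRosen1990] K. Ireland, M. Rosen, GTM 84, Prop. 9.1.4 (primes of `ℤ[ω]`).
-/

noncomputable section

open QuadraticAlgebra NumberField IsDedekindDomain IsDedekindDomain.HeightOneSpectrum
open WithZero (log exp)
open scoped WithZero
open Literature.NumberTheory.EllipticCurves.MordellDescent (cubeClass CubeUnits cubeClass_mul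
  cubeClass_neg cubeClass_mul_pow_three cubeClass_eq_cubeClass_iff cubeClass_pow_three)

namespace Literature.NumberTheory.NumberFields

namespace K3

section Split₃

variable {N : ℕ} (hN0 : N ≠ 0) (hN : ∀ q ∈ N.primeFactors, q = 2 ∨ q % 3 = 2)
  {p₁ : ℕ} (hp₁ : p₁.Prime) (hp₁1 : p₁ % 3 = 1) {a₁ b₁ : ℤ} (hab₁ : a₁ ^ 2 - a₁ * b₁ + b₁ ^ 2 = p₁)
  {p₂ : ℕ} (hp₂ : p₂.Prime) (hp₂1 : p₂ % 3 = 1) {a₂ b₂ : ℤ} (hab₂ : a₂ ^ 2 - a₂ * b₂ + b₂ ^ 2 = p₂)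
  {p₃ : ℕ} (hp₃ : p₃.Prime) (hp₃1 : p₃ % 3 = 1) {a₃ b₃ : ℤ} (hab₃ : a₃ ^ 2 - a₃ * b₃ + b₃ ^ 2 = p₃)
  (hne₁₂ : p₁ ≠ p₂) (hne₁₃ : p₁ ≠ p₃) (hne₂₃ : p₂ ≠ p₃)

/-! ## Prime elements dividing `3Np₁p₂p₃` -/

include hN0 hN hp₁ hab₁ hp₂ hab₂ hp₃ hab₃ in
/-- **A prime element dividing `3Np₁p₂p₃` is associated to `λ`, to an inert `q ∣ N`, or to one of `ϖ₁, ϖ̄₁, ϖ₂, ϖ̄₂, ϖ₃, ϖ̄₃`.**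
[cite: IrelandRosen1990, Prop. 9.1.4] -/
theorem associated_of_prime_of_dvd_three_mul_split₃ {r : 𝓞 K3} (hr : Prime r)
    (h : r ∣ ((3 * N * p₁ * p₂ * p₃ : ℕ) : 𝓞 K3)) :
    ((Associated r lamInt ∨ (∃ q ∈ N.primeFactors, Associated r ((q : ℕ) : 𝓞 K3)) ∨
      Associated r (mkInt a₁ b₁) ∨ Associated r (mkInt (a₁ - b₁) (-b₁))) ∨
      Associated r (mkInt a₂ b₂) ∨ Associated r (mkInt (a₂ - b₂) (-b₂))) ∨
      Associated r (mkInt a₃ b₃) ∨ Associated r (mkInt (a₃ - b₃) (-b₃)) := by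
  have hsplit : ((3 * N * p₁ * p₂ * p₃ : ℕ) : 𝓞 K3) =
      ((3 * N * p₁ * p₂ : ℕ) : 𝓞 K3) * (mkInt a₃ b₃ * mkInt (a₃ - b₃) (-b₃)) := by
    rw [← natCast_eq_mkInt_mul_conj hab₃]; push_cast; ring
  rw [hsplit] at h
  rcases hr.dvd_or_dvd h with h3N | hP
  · exact Or.inl (associated_of_prime_of_dvd_three_mul_split₂ hN0 hN hp₁ hab₁ hp₂ hab₂ hr h3N)
  · rcases hr.dvd_or_dvd hP with h1 | h2
    · exact Or.inr (Or.inl (hr.irreducible.associated_of_dvd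
        (prime_mkInt_of_norm_eq_prime hp₃ hab₃).irreducible h1))
    · exact Or.inr (Or.inr (hr.irreducible.associated_of_dvd
        (prime_mkInt_of_norm_eq_prime hp₃ ((norm_conj_eq a₃ b₃).trans hab₃)).irreducible h2))

include hN0 hN hp₁ hab₁ hp₂ hab₂ hp₃ hab₃ in
/-- Every prime element dividing `3Np₁p₂p₃` is associated to one of the generators, as a family on
`Option N.primeFactors ⊕ (Bool ⊕ (Bool ⊕ Bool))`. [folklore] -/
private theorem gensSplit₃_spec (r : 𝓞 K3) (hr : Prime r) (h : r ∣ ((3 * N * p₁ * p₂ * p₃ : ℕ) : 𝓞 K3)) :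
    ∃ i : Option N.primeFactors ⊕ (Bool ⊕ (Bool ⊕ Bool)), Associated r
      ((fun i : Option N.primeFactors ⊕ (Bool ⊕ (Bool ⊕ Bool)) => Sum.elim (fun o : Option N.primeFactors => Option.elim o lamInt (fun q => ((q : ℕ) : 𝓞 K3)))
      (fun c : Bool ⊕ (Bool ⊕ Bool) => Sum.elim (fun c₁ : Bool => cond c₁ (mkInt a₁ b₁) (mkInt (a₁ - b₁) (-b₁)))
        (fun c' : Bool ⊕ Bool => Sum.elim (fun c₂ : Bool => cond c₂ (mkInt a₂ b₂) (mkInt (a₂ - b₂) (-b₂)))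
          (fun c₃ : Bool => cond c₃ (mkInt a₃ b₃) (mkInt (a₃ - b₃) (-b₃))) c') c) i) i) := by
  rcases associated_of_prime_of_dvd_three_mul_split₃ hN0 hN hp₁ hab₁ hp₂ hab₂ hp₃ hab₃ hr h with
    ((h | ⟨q, hq, h⟩ | h | h) | h | h) | h | h
  · exact ⟨Sum.inl none, h⟩
  · exact ⟨Sum.inl (some ⟨q, hq⟩), h⟩
  · exact ⟨Sum.inr (Sum.inl true), h⟩
  · exact ⟨Sum.inr (Sum.inl false), h⟩
  · exact ⟨Sum.inr (Sum.inr (Sum.inl true)), h⟩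
  · exact ⟨Sum.inr (Sum.inr (Sum.inl false)), h⟩
  · exact ⟨Sum.inr (Sum.inr (Sum.inr true)), h⟩
  · exact ⟨Sum.inr (Sum.inr (Sum.inr false)), h⟩

/-! ## The normal form -/

include hN0 hN hp₁ hab₁ hp₂ hab₂ hp₃ hab₃ in
/-- **Normal form of `K(S, 3)` with three split primes**: if `x ∈ K3ˣ` has `3 ∣ ord_v(x)` for every finite place `v ∌ 3Np₁p₂p₃`, then
`x = s ζ^i (ζ − 1)^j (∏_{q ∣ N} q^{e q}) ϖ₁^{k₁} ϖ̄₁^{l₁} ϖ₂^{k₂} ϖ̄₂^{l₂} ϖ₃^{k₃} ϖ̄₃^{l₃} w³` with `s = ±1`, all exponents `< 3`, `w ≠ 0`.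
[cite: SilvermanAEC2009, Prop. VIII.1.6 (proof)] -/
theorem exists_normal_form_split₃ {x : K3} (hx : x ≠ 0)
    (hval : ∀ v : HeightOneSpectrum (𝓞 K3), ((3 * N * p₁ * p₂ * p₃ : ℕ) : 𝓞 K3) ∉ v.asIdeal →
      (3 : ℤ) ∣ log (v.valuation K3 x)) :
    ∃ (s : ℤ) (i j : ℕ) (e : ℕ → ℕ) (k₁ l₁ k₂ l₂ k₃ l₃ : ℕ) (w : K3), (s = 1 ∨ s = -1) ∧ i < 3 ∧ j < 3 ∧ (∀ q, e q < 3) ∧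
      k₁ < 3 ∧ l₁ < 3 ∧ k₂ < 3 ∧ l₂ < 3 ∧ k₃ < 3 ∧ l₃ < 3 ∧ w ≠ 0 ∧
      x = s * zeta ^ i * (zeta - 1) ^ j * (∏ q ∈ N.primeFactors, (q : K3) ^ e q) *
        (⟨a₁, b₁⟩ : K3) ^ k₁ * (⟨a₁ - b₁, -b₁⟩ : K3) ^ l₁ * (⟨a₂, b₂⟩ : K3) ^ k₂ * (⟨a₂ - b₂, -b₂⟩ : K3) ^ l₂ *
        (⟨a₃, b₃⟩ : K3) ^ k₃ * (⟨a₃ - b₃, -b₃⟩ : K3) ^ l₃ * w ^ 3 := by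
  classical
  obtain ⟨u, e, w, he, hw, h⟩ := exists_eq_unit_mul_prod_pow_mul_pow (K := K3) ((3 * N * p₁ * p₂ * p₃ : ℕ) : 𝓞 K3)
    (fun i : Option N.primeFactors ⊕ (Bool ⊕ (Bool ⊕ Bool)) => Sum.elim (fun o : Option N.primeFactors => Option.elim o lamInt (fun q => ((q : ℕ) : 𝓞 K3)))
      (fun c : Bool ⊕ (Bool ⊕ Bool) => Sum.elim (fun c₁ : Bool => cond c₁ (mkInt a₁ b₁) (mkInt (a₁ - b₁) (-b₁)))
        (fun c' : Bool ⊕ Bool => Sum.elim (fun c₂ : Bool => cond c₂ (mkInt a₂ b₂) (mkInt (a₂ - b₂) (-b₂)))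
          (fun c₃ : Bool => cond c₃ (mkInt a₃ b₃) (mkInt (a₃ - b₃) (-b₃))) c') c) i)
    (gensSplit₃_spec hN0 hN hp₁ hab₁ hp₂ hab₂ hp₃ hab₃) (n := 3) (by norm_num) hx hval
  obtain ⟨s, i, hs, hi, hu⟩ := exists_coe_unit_eq u
  refine ⟨s, i, e (Sum.inl none), fun q => if hq : q ∈ N.primeFactors then e (Sum.inl (some ⟨q, hq⟩)) else 0,
    e (Sum.inr (Sum.inl true)), e (Sum.inr (Sum.inl false)), e (Sum.inr (Sum.inr (Sum.inl true))),
    e (Sum.inr (Sum.inr (Sum.inl false))), e (Sum.inr (Sum.inr (Sum.inr true))), e (Sum.inr (Sum.inr (Sum.inr false))),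
    w, hs, hi, he _, fun q => ?_, he _, he _, he _, he _, he _, he _, hw, ?_⟩
  · by_cases hq : q ∈ N.primeFactors
    · dsimp only; rw [dif_pos hq]; exact he _
    · dsimp only; rw [dif_neg hq]; norm_num
  · rw [h, Fintype.prod_sum_type, Fintype.prod_sum_type, Fintype.prod_sum_type, Fintype.prod_option, Fintype.prod_bool,
      Fintype.prod_bool, Fintype.prod_bool, hu]
    have hprod : (∏ y : N.primeFactors, (((fun i : Option N.primeFactors ⊕ (Bool ⊕ (Bool ⊕ Bool)) => Sum.elim (fun o : Option N.primeFactors => Option.elim o lamInt (fun q => ((q : ℕ) : 𝓞 K3)))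
      (fun c : Bool ⊕ (Bool ⊕ Bool) => Sum.elim (fun c₁ : Bool => cond c₁ (mkInt a₁ b₁) (mkInt (a₁ - b₁) (-b₁)))
        (fun c' : Bool ⊕ Bool => Sum.elim (fun c₂ : Bool => cond c₂ (mkInt a₂ b₂) (mkInt (a₂ - b₂) (-b₂)))
          (fun c₃ : Bool => cond c₃ (mkInt a₃ b₃) (mkInt (a₃ - b₃) (-b₃))) c') c) i) (Sum.inl (some y)) : 𝓞 K3) : K3) ^ e (Sum.inl (some y))) =
        ∏ q ∈ N.primeFactors, (q : K3) ^ (if hq : q ∈ N.primeFactors then e (Sum.inl (some ⟨q, hq⟩)) else 0) := by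
      rw [← Finset.prod_coe_sort N.primeFactors]
      refine Finset.prod_congr rfl fun y _ => ?_
      rw [dif_pos y.2]
      simp only [Sum.elim_inl, Option.elim]
      rw [coe_natCast_ringOfIntegers]
    rw [hprod]
    simp only [Sum.elim_inl, Sum.elim_inr, Option.elim, cond_true, cond_false, coe_lamInt, coe_mkInt]
    push_cast
    ring

/-! ## Norms -/

include hab₁ hab₂ hab₃ in
/-- **The norm of a three-split normal form**: `3^j (∏ (q²)^{e_q}) p₁^{k₁+l₁} p₂^{k₂+l₂} p₃^{k₃+l₃} N(w)³`.
[cite: CohenPazuki2009, Definition 1.3 (G₃) with Theorem 2.1] -/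
theorem norm_normalForm_split₃ {s : ℤ} (hs : s = 1 ∨ s = -1) (i j : ℕ) (e : ℕ → ℕ) (k₁ l₁ k₂ l₂ k₃ l₃ : ℕ) (w : K3) :
    QuadraticAlgebra.norm ((s : K3) * zeta ^ i * (zeta - 1) ^ j * (∏ q ∈ N.primeFactors, (q : K3) ^ e q) *
        (⟨a₁, b₁⟩ : K3) ^ k₁ * (⟨a₁ - b₁, -b₁⟩ : K3) ^ l₁ * (⟨a₂, b₂⟩ : K3) ^ k₂ * (⟨a₂ - b₂, -b₂⟩ : K3) ^ l₂ *
        (⟨a₃, b₃⟩ : K3) ^ k₃ * (⟨a₃ - b₃, -b₃⟩ : K3) ^ l₃ * w ^ 3) =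
      3 ^ j * (∏ q ∈ N.primeFactors, ((q : ℚ) ^ 2) ^ e q) * (p₁ : ℚ) ^ (k₁ + l₁) * (p₂ : ℚ) ^ (k₂ + l₂) * (p₃ : ℚ) ^ (k₃ + l₃) *
        (QuadraticAlgebra.norm w) ^ 3 := by
  rw [map_mul, map_mul, map_mul, map_mul, map_mul, map_mul, map_mul, map_mul, map_mul, map_mul, map_pow, map_pow, map_pow,
    map_pow, map_pow, map_pow, map_pow, map_pow, map_pow, norm_prodPow, norm_zeta, norm_zeta_sub_one, norm_varpi hab₁,
    norm_varpi_conj hab₁, norm_varpi hab₂, norm_varpi_conj hab₂, norm_varpi hab₃, norm_varpi_conj hab₃]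
  have hs1 : QuadraticAlgebra.norm (s : K3) = 1 := by
    have : QuadraticAlgebra.norm ((s : ℤ) : K3) = 1 := by
      rw [norm_intCast]; rcases hs with rfl | rfl <;> norm_num
    exact_mod_cast this
  rw [hs1, pow_add, pow_add, pow_add]
  ring

/-- `N(w) ≠ 0` for `w ≠ 0` (private copy). [cite: CohenPazuki2009, Definition 1.3 (G₃)] -/
private theorem norm_ne_zero₃ {w : K3} (hw : w ≠ 0) : QuadraticAlgebra.norm w ≠ 0 := by
  intro h0
  have h := algebraMap_norm_eq_mul_star w
  rw [h0, map_zero] at h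
  rcases mul_eq_zero.mp h.symm with h1 | h1
  · exact hw h1
  · exact hw (star_eq_zero.mp h1)

/-- `v_p(c) = 0` for distinct primes `p ≠ c` (bookkeeping, private). [cite: SilvermanAEC2009, Prop. VIII.1.6 (proof)] -/
private theorem padicValRat_natCast_eq_zero_of_ne' {p c : ℕ} [hp : Fact p.Prime] (hc : c.Prime) (hpc : p ≠ c) :
    padicValRat p (c : ℚ) = 0 := by
  rw [padicValRat.of_nat]
  have : padicValNat p c = 0 := padicValNat.eq_zero_of_not_dvd fun h =>
    hpc ((Nat.prime_dvd_prime_iff_eq hp.out hc).mp h)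
  rw [this]; simp

/-! ## The norm-cube condition -/

include hN0 hN hp₁ hp₁1 hab₁ hp₂ hp₂1 hab₂ hp₃ hp₃1 hab₃ hne₁₂ hne₁₃ hne₂₃ in
/-- **The norm-cube condition (three split primes)**: norm a rational cube ⇒ `j = 0`, `e_q = 0`, `3 ∣ kᵢ + lᵢ` (`i = 1, 2, 3`).
[cite: CohenPazuki2009, Definition 1.3 (G₃) with Theorem 2.1] -/
theorem exponents_of_norm_cube_split₃ {s : ℤ} (hs : s = 1 ∨ s = -1) {i j : ℕ} {e : ℕ → ℕ} {k₁ l₁ k₂ l₂ k₃ l₃ : ℕ}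
    (hj : j < 3) (he : ∀ q, e q < 3) {w : K3} (hw : w ≠ 0) {r : ℚ}
    (hr : QuadraticAlgebra.norm ((s : K3) * zeta ^ i * (zeta - 1) ^ j *
      (∏ q ∈ N.primeFactors, (q : K3) ^ e q) * (⟨a₁, b₁⟩ : K3) ^ k₁ * (⟨a₁ - b₁, -b₁⟩ : K3) ^ l₁ *
        (⟨a₂, b₂⟩ : K3) ^ k₂ * (⟨a₂ - b₂, -b₂⟩ : K3) ^ l₂ * (⟨a₃, b₃⟩ : K3) ^ k₃ * (⟨a₃ - b₃, -b₃⟩ : K3) ^ l₃ * w ^ 3) = r ^ 3) :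
    j = 0 ∧ (∀ q ∈ N.primeFactors, e q = 0) ∧ 3 ∣ k₁ + l₁ ∧ 3 ∣ k₂ + l₂ ∧ 3 ∣ k₃ + l₃ := by
  haveI : Fact (Nat.Prime 3) := ⟨Nat.prime_three⟩
  haveI : Fact p₁.Prime := ⟨hp₁⟩
  haveI : Fact p₂.Prime := ⟨hp₂⟩
  haveI : Fact p₃.Prime := ⟨hp₃⟩
  rw [norm_normalForm_split₃ hab₁ hab₂ hab₃ hs] at hr
  have hNw := norm_ne_zero₃ hw
  set Nw := QuadraticAlgebra.norm w with hNwdef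
  have hprimes : ∀ q ∈ N.primeFactors, q.Prime := fun q hq => Nat.prime_of_mem_primeFactors hq
  have hp10 : (p₁ : ℚ) ≠ 0 := Nat.cast_ne_zero.mpr hp₁.ne_zero
  have hp20 : (p₂ : ℚ) ≠ 0 := Nat.cast_ne_zero.mpr hp₂.ne_zero
  have hp30 : (p₃ : ℚ) ≠ 0 := Nat.cast_ne_zero.mpr hp₃.ne_zero
  have hP : (∏ q ∈ N.primeFactors, ((q : ℚ) ^ 2) ^ e q) ≠ 0 :=
    Finset.prod_ne_zero_iff.mpr fun q hq => pow_ne_zero _ (pow_ne_zero _ (Nat.cast_ne_zero.mpr (hprimes q hq).ne_zero))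
  set A := (3 : ℚ) ^ j * (∏ q ∈ N.primeFactors, ((q : ℚ) ^ 2) ^ e q) * (p₁ : ℚ) ^ (k₁ + l₁) * (p₂ : ℚ) ^ (k₂ + l₂) *
    (p₃ : ℚ) ^ (k₃ + l₃) with hAdef
  have hA3 : (3 : ℚ) ^ j * (∏ q ∈ N.primeFactors, ((q : ℚ) ^ 2) ^ e q) * (p₁ : ℚ) ^ (k₁ + l₁) * (p₂ : ℚ) ^ (k₂ + l₂) ≠ 0 :=
    mul_ne_zero (mul_ne_zero (mul_ne_zero (pow_ne_zero _ (by norm_num)) hP) (pow_ne_zero _ hp10)) (pow_ne_zero _ hp20)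
  have hA : A ≠ 0 := mul_ne_zero hA3 (pow_ne_zero _ hp30)
  have hr0 : r ≠ 0 := by
    rintro rfl
    rw [zero_pow three_ne_zero] at hr
    exact (mul_ne_zero hA (pow_ne_zero 3 hNw)) hr
  have key : A = (r / Nw) ^ 3 := by
    rw [div_pow, eq_div_iff (pow_ne_zero 3 hNw), hr]
  have h3N : (3 : ℕ) ∉ N.primeFactors := fun h => not_three_dvd_of_mem_primeFactors hN0 hN h (dvd_refl 3)
  have hp1N : p₁ ∉ N.primeFactors := fun h => by rcases hN p₁ h with h2 | h2 <;> omega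
  have hp2N : p₂ ∉ N.primeFactors := fun h => by rcases hN p₂ h with h2 | h2 <;> omega
  have hp3N : p₃ ∉ N.primeFactors := fun h => by rcases hN p₃ h with h2 | h2 <;> omega
  have hp13 : p₁ ≠ 3 := fun h => by omega
  have hp23 : p₂ ≠ 3 := fun h => by omega
  have hp33 : p₃ ≠ 3 := fun h => by omega
  have e3 : (3 : ℚ) = ((3 : ℕ) : ℚ) := by norm_num
  have vA : ∀ (c : ℕ) [Fact c.Prime], padicValRat c A = padicValRat c ((3 : ℚ) ^ j) +
      padicValRat c (∏ q ∈ N.primeFactors, ((q : ℚ) ^ 2) ^ e q) + padicValRat c ((p₁ : ℚ) ^ (k₁ + l₁)) +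
      padicValRat c ((p₂ : ℚ) ^ (k₂ + l₂)) + padicValRat c ((p₃ : ℚ) ^ (k₃ + l₃)) := by
    intro c _
    rw [hAdef, padicValRat.mul hA3 (pow_ne_zero _ hp30),
      padicValRat.mul (mul_ne_zero (mul_ne_zero (pow_ne_zero _ (by norm_num)) hP) (pow_ne_zero _ hp10)) (pow_ne_zero _ hp20),
      padicValRat.mul (mul_ne_zero (pow_ne_zero _ (by norm_num)) hP) (pow_ne_zero _ hp10),
      padicValRat.mul (pow_ne_zero _ (by norm_num)) hP]
  have dA : ∀ (c : ℕ) [Fact c.Prime], (3 : ℤ) ∣ padicValRat c A := fun c _ =>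
    ⟨padicValRat c (r / Nw), by rw [key, padicValRat.pow]; ring⟩
  have v3 : padicValRat 3 A = j := by
    rw [vA 3, padicValRat.pow, padicValRat.pow, padicValRat.pow, padicValRat.pow, e3, padicValRat.self (by norm_num),
      padicValRat_prodPow_sq 3 _ hprimes, if_neg h3N, padicValRat_natCast_eq_zero_of_ne' hp₁ (Ne.symm hp13),
      padicValRat_natCast_eq_zero_of_ne' hp₂ (Ne.symm hp23), padicValRat_natCast_eq_zero_of_ne' hp₃ (Ne.symm hp33)]
    ring
  have d3 : (3 : ℤ) ∣ (j : ℤ) := v3 ▸ dA 3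
  have vp1 : padicValRat p₁ A = ((k₁ + l₁ : ℕ) : ℤ) := by
    rw [vA p₁, padicValRat.pow, padicValRat.pow, padicValRat.pow, padicValRat.pow, e3,
      padicValRat_natCast_eq_zero_of_ne' Nat.prime_three hp13, padicValRat_prodPow_sq p₁ _ hprimes, if_neg hp1N,
      padicValRat.self hp₁.one_lt, padicValRat_natCast_eq_zero_of_ne' hp₂ hne₁₂, padicValRat_natCast_eq_zero_of_ne' hp₃ hne₁₃]
    push_cast; ring
  have dp1 : (3 : ℤ) ∣ ((k₁ + l₁ : ℕ) : ℤ) := vp1 ▸ dA p₁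
  have vp2 : padicValRat p₂ A = ((k₂ + l₂ : ℕ) : ℤ) := by
    rw [vA p₂, padicValRat.pow, padicValRat.pow, padicValRat.pow, padicValRat.pow, e3,
      padicValRat_natCast_eq_zero_of_ne' Nat.prime_three hp23, padicValRat_prodPow_sq p₂ _ hprimes, if_neg hp2N,
      padicValRat_natCast_eq_zero_of_ne' hp₁ (Ne.symm hne₁₂), padicValRat.self hp₂.one_lt,
      padicValRat_natCast_eq_zero_of_ne' hp₃ hne₂₃]
    push_cast; ring
  have dp2 : (3 : ℤ) ∣ ((k₂ + l₂ : ℕ) : ℤ) := vp2 ▸ dA p₂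
  have vp3 : padicValRat p₃ A = ((k₃ + l₃ : ℕ) : ℤ) := by
    rw [vA p₃, padicValRat.pow, padicValRat.pow, padicValRat.pow, padicValRat.pow, e3,
      padicValRat_natCast_eq_zero_of_ne' Nat.prime_three hp33, padicValRat_prodPow_sq p₃ _ hprimes, if_neg hp3N,
      padicValRat_natCast_eq_zero_of_ne' hp₁ (Ne.symm hne₁₃), padicValRat_natCast_eq_zero_of_ne' hp₂ (Ne.symm hne₂₃),
      padicValRat.self hp₃.one_lt]
    push_cast; ring
  have dp3 : (3 : ℤ) ∣ ((k₃ + l₃ : ℕ) : ℤ) := vp3 ▸ dA p₃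
  refine ⟨by omega, fun q₀ hq₀ => ?_, by omega, by omega, by omega⟩
  haveI : Fact q₀.Prime := ⟨hprimes q₀ hq₀⟩
  have hq3 : q₀ ≠ 3 := fun h => h3N (h ▸ hq₀)
  have hq1 : q₀ ≠ p₁ := fun h => hp1N (h ▸ hq₀)
  have hq2 : q₀ ≠ p₂ := fun h => hp2N (h ▸ hq₀)
  have hq3' : q₀ ≠ p₃ := fun h => hp3N (h ▸ hq₀)
  have vq : padicValRat q₀ A = 2 * (e q₀ : ℤ) := by
    rw [vA q₀, padicValRat.pow, padicValRat.pow, padicValRat.pow, padicValRat.pow, e3,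
      padicValRat_natCast_eq_zero_of_ne' Nat.prime_three hq3, padicValRat_prodPow_sq q₀ _ hprimes, if_pos hq₀,
      padicValRat_natCast_eq_zero_of_ne' hp₁ hq1, padicValRat_natCast_eq_zero_of_ne' hp₂ hq2,
      padicValRat_natCast_eq_zero_of_ne' hp₃ hq3']
    ring
  have dq : (3 : ℤ) ∣ 2 * (e q₀ : ℤ) := vq ▸ dA q₀
  have := he q₀
  omega

/-! ## The norm-cube box with three split primes -/

/-- `ϖ ≠ 0` (bookkeeping, private). [cite: IrelandRosen1990, Prop. 9.1.4] -/
private theorem varpi_ne_zero₃ {p : ℕ} (hp : p.Prime) {a b : ℤ} (hab : a ^ 2 - a * b + b ^ 2 = p) : (⟨a, b⟩ : K3) ≠ 0 := by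
  intro h0
  have hp0 : (p : ℤ) ≠ 0 := by exact_mod_cast hp.ne_zero
  have ha : (a : ℚ) = 0 := congrArg QuadraticAlgebra.re h0
  have hb : (b : ℚ) = 0 := congrArg QuadraticAlgebra.im h0
  have ha' : a = 0 := by exact_mod_cast ha
  have hb' : b = 0 := by exact_mod_cast hb
  subst ha'; subst hb'
  exact hp0 (by rw [← hab]; ring)

/-- `ϖ̄ ≠ 0` (bookkeeping, private). [cite: IrelandRosen1990, Prop. 9.1.4] -/
private theorem varpi_conj_ne_zero₃ {p : ℕ} (hp : p.Prime) {a b : ℤ} (hab : a ^ 2 - a * b + b ^ 2 = p) :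
    (⟨a - b, -b⟩ : K3) ≠ 0 := by
  have h := varpi_ne_zero₃ hp ((norm_conj_eq a b).trans hab)
  intro h0; apply h
  have e : (⟨((a - b : ℤ) : ℚ), ((-b : ℤ) : ℚ)⟩ : K3) = ⟨(a : ℚ) - b, -b⟩ := by push_cast; rfl
  rw [e]; exact h0

include hN0 hN hp₁ hp₁1 hab₁ hp₂ hp₂1 hab₂ hp₃ hp₃1 hab₃ hne₁₂ hne₁₃ hne₂₃ in
/-- **`G₃ ∩ K(S, 3)` with three split primes**: an element `x ∈ K3ˣ` with `3 ∣ ord_v(x)` off `3Np₁p₂p₃` and norm a rational cube has cube class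
`[ζ^i (ϖ₁ϖ̄₁²)^{k₁} (ϖ₂ϖ̄₂²)^{k₂} (ϖ₃ϖ̄₃²)^{k₃}]`, `i, kᵢ < 3`. [cite: CohenPazuki2009, Definition 1.3 and Theorem 2.1] -/
theorem exists_cubeClass_eq_of_norm_cube_split₃ {x : K3} (hx : x ≠ 0)
    (hval : ∀ v : HeightOneSpectrum (𝓞 K3), ((3 * N * p₁ * p₂ * p₃ : ℕ) : 𝓞 K3) ∉ v.asIdeal →
      (3 : ℤ) ∣ log (v.valuation K3 x))
    (hnorm : ∃ r : ℚ, QuadraticAlgebra.norm x = r ^ 3) :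
    ∃ i k₁ k₂ k₃ : ℕ, i < 3 ∧ k₁ < 3 ∧ k₂ < 3 ∧ k₃ < 3 ∧
      cubeClass x = cubeClass (zeta ^ i * ((⟨a₁, b₁⟩ : K3) * (⟨a₁ - b₁, -b₁⟩ : K3) ^ 2) ^ k₁ *
        ((⟨a₂, b₂⟩ : K3) * (⟨a₂ - b₂, -b₂⟩ : K3) ^ 2) ^ k₂ * ((⟨a₃, b₃⟩ : K3) * (⟨a₃ - b₃, -b₃⟩ : K3) ^ 2) ^ k₃) := by
  obtain ⟨s, i, j, e, k₁, l₁, k₂, l₂, k₃, l₃, w, hs, hi, hj, he, hk₁, hl₁, hk₂, hl₂, hk₃, hl₃, hw, hx_eq⟩ :=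
    exists_normal_form_split₃ hN0 hN hp₁ hab₁ hp₂ hab₂ hp₃ hab₃ hx hval
  obtain ⟨r, hr⟩ := hnorm
  rw [hx_eq] at hr
  obtain ⟨rfl, he0, hkl₁, hkl₂, hkl₃⟩ :=
    exponents_of_norm_cube_split₃ hN0 hN hp₁ hp₁1 hab₁ hp₂ hp₂1 hab₂ hp₃ hp₃1 hab₃ hne₁₂ hne₁₃ hne₂₃ hs hj he hw hr
  refine ⟨i, k₁, k₂, k₃, hi, hk₁, hk₂, hk₃, ?_⟩
  have hprod : (∏ q ∈ N.primeFactors, (q : K3) ^ e q) = 1 :=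
    Finset.prod_eq_one fun q hq => by rw [he0 q hq, pow_zero]
  have hz : (zeta : K3) ≠ 0 := isPrimitiveRoot_zeta.ne_zero (by norm_num)
  have hs0 : (s : K3) ≠ 0 := by rcases hs with rfl | rfl <;> norm_num
  have hϖ₁ := varpi_ne_zero₃ hp₁ hab₁
  have hϖ₁' := varpi_conj_ne_zero₃ hp₁ hab₁
  have hϖ₂ := varpi_ne_zero₃ hp₂ hab₂
  have hϖ₂' := varpi_conj_ne_zero₃ hp₂ hab₂
  have hϖ₃ := varpi_ne_zero₃ hp₃ hab₃
  have hϖ₃' := varpi_conj_ne_zero₃ hp₃ hab₃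
  have hkl₁' : k₁ = 0 ∧ l₁ = 0 ∨ k₁ = 1 ∧ l₁ = 2 ∨ k₁ = 2 ∧ l₁ = 1 := by omega
  have hkl₂' : k₂ = 0 ∧ l₂ = 0 ∨ k₂ = 1 ∧ l₂ = 2 ∨ k₂ = 2 ∧ l₂ = 1 := by omega
  have hkl₃' : k₃ = 0 ∧ l₃ = 0 ∨ k₃ = 1 ∧ l₃ = 2 ∨ k₃ = 2 ∧ l₃ = 1 := by omega
  set A₁ := (⟨a₁, b₁⟩ : K3) with hA₁
  set B₁ := (⟨a₁ - b₁, -b₁⟩ : K3) with hB₁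
  set A₂ := (⟨a₂, b₂⟩ : K3) with hA₂
  set B₂ := (⟨a₂ - b₂, -b₂⟩ : K3) with hB₂
  set A₃ := (⟨a₃, b₃⟩ : K3) with hA₃
  set B₃ := (⟨a₃ - b₃, -b₃⟩ : K3) with hB₃
  have hX : (zeta : K3) ^ i ≠ 0 := pow_ne_zero _ hz
  have hg₁ : (A₁ * B₁ ^ 2) ^ k₁ ≠ 0 := pow_ne_zero _ (mul_ne_zero hϖ₁ (pow_ne_zero _ hϖ₁'))
  have hg₂ : (A₂ * B₂ ^ 2) ^ k₂ ≠ 0 := pow_ne_zero _ (mul_ne_zero hϖ₂ (pow_ne_zero _ hϖ₂'))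
  have hg₃ : (A₃ * B₃ ^ 2) ^ k₃ ≠ 0 := pow_ne_zero _ (mul_ne_zero hϖ₃ (pow_ne_zero _ hϖ₃'))
  have hcore : (zeta : K3) ^ i * A₁ ^ k₁ * B₁ ^ l₁ * A₂ ^ k₂ * B₂ ^ l₂ * A₃ ^ k₃ * B₃ ^ l₃ ≠ 0 :=
    mul_ne_zero (mul_ne_zero (mul_ne_zero (mul_ne_zero (mul_ne_zero (mul_ne_zero hX (pow_ne_zero _ hϖ₁))
      (pow_ne_zero _ hϖ₁')) (pow_ne_zero _ hϖ₂)) (pow_ne_zero _ hϖ₂')) (pow_ne_zero _ hϖ₃)) (pow_ne_zero _ hϖ₃')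
  have hY : (s : K3) * (zeta : K3) ^ i * A₁ ^ k₁ * B₁ ^ l₁ * A₂ ^ k₂ * B₂ ^ l₂ * A₃ ^ k₃ * B₃ ^ l₃ ≠ 0 := by
    have := mul_ne_zero hs0 hcore
    simpa only [mul_assoc] using this
  have step0 : cubeClass x = cubeClass ((zeta : K3) ^ i * A₁ ^ k₁ * B₁ ^ l₁ * A₂ ^ k₂ * B₂ ^ l₂ * A₃ ^ k₃ * B₃ ^ l₃) := by
    rw [hx_eq, hprod, pow_zero, mul_one, mul_one, cubeClass_mul_pow_three hY hw]
    rcases hs with rfl | rfl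
    · push_cast; rw [one_mul]
    · push_cast
      rw [show (-1 : K3) * zeta ^ i * A₁ ^ k₁ * B₁ ^ l₁ * A₂ ^ k₂ * B₂ ^ l₂ * A₃ ^ k₃ * B₃ ^ l₃ =
          -((zeta : K3) ^ i * A₁ ^ k₁ * B₁ ^ l₁ * A₂ ^ k₂ * B₂ ^ l₂ * A₃ ^ k₃ * B₃ ^ l₃) by ring, cubeClass_neg]
  -- convert pair 3, then pair 2, then pair 1
  have step3 : cubeClass ((zeta : K3) ^ i * A₁ ^ k₁ * B₁ ^ l₁ * A₂ ^ k₂ * B₂ ^ l₂ * A₃ ^ k₃ * B₃ ^ l₃) =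
      cubeClass ((zeta : K3) ^ i * A₁ ^ k₁ * B₁ ^ l₁ * A₂ ^ k₂ * B₂ ^ l₂ * (A₃ * B₃ ^ 2) ^ k₃) :=
    cubeClass_mul_varpi_pow_eq hϖ₃ hϖ₃' (mul_ne_zero (mul_ne_zero (mul_ne_zero (mul_ne_zero hX (pow_ne_zero _ hϖ₁))
      (pow_ne_zero _ hϖ₁')) (pow_ne_zero _ hϖ₂)) (pow_ne_zero _ hϖ₂')) hkl₃'
  have step2 : cubeClass ((zeta : K3) ^ i * A₁ ^ k₁ * B₁ ^ l₁ * A₂ ^ k₂ * B₂ ^ l₂ * (A₃ * B₃ ^ 2) ^ k₃) =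
      cubeClass ((zeta : K3) ^ i * A₁ ^ k₁ * B₁ ^ l₁ * (A₃ * B₃ ^ 2) ^ k₃ * (A₂ * B₂ ^ 2) ^ k₂) := by
    have h := cubeClass_mul_varpi_pow_eq hϖ₂ hϖ₂' (mul_ne_zero (mul_ne_zero (mul_ne_zero hX (pow_ne_zero _ hϖ₁))
      (pow_ne_zero _ hϖ₁')) hg₃) hkl₂' (X := (zeta : K3) ^ i * A₁ ^ k₁ * B₁ ^ l₁ * (A₃ * B₃ ^ 2) ^ k₃)
    rw [show (zeta : K3) ^ i * A₁ ^ k₁ * B₁ ^ l₁ * A₂ ^ k₂ * B₂ ^ l₂ * (A₃ * B₃ ^ 2) ^ k₃ =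
        (zeta : K3) ^ i * A₁ ^ k₁ * B₁ ^ l₁ * (A₃ * B₃ ^ 2) ^ k₃ * A₂ ^ k₂ * B₂ ^ l₂ by ring, h]
  have step1 : cubeClass ((zeta : K3) ^ i * A₁ ^ k₁ * B₁ ^ l₁ * (A₃ * B₃ ^ 2) ^ k₃ * (A₂ * B₂ ^ 2) ^ k₂) =
      cubeClass ((zeta : K3) ^ i * (A₁ * B₁ ^ 2) ^ k₁ * (A₂ * B₂ ^ 2) ^ k₂ * (A₃ * B₃ ^ 2) ^ k₃) := by
    have h := cubeClass_mul_varpi_pow_eq hϖ₁ hϖ₁' (mul_ne_zero (mul_ne_zero hX hg₃) hg₂) hkl₁'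
      (X := (zeta : K3) ^ i * (A₃ * B₃ ^ 2) ^ k₃ * (A₂ * B₂ ^ 2) ^ k₂)
    rw [show (zeta : K3) ^ i * A₁ ^ k₁ * B₁ ^ l₁ * (A₃ * B₃ ^ 2) ^ k₃ * (A₂ * B₂ ^ 2) ^ k₂ =
        (zeta : K3) ^ i * (A₃ * B₃ ^ 2) ^ k₃ * (A₂ * B₂ ^ 2) ^ k₂ * A₁ ^ k₁ * B₁ ^ l₁ by ring, h]
    congr 1; ring
  rw [step0, step3, step2, step1]

end Split₃

end K3

end Literature.NumberTheory.NumberFields
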